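import Summits.BirchSwinnertonDyer.BirchSwinnertonDyer.Theorems.SignedLowerHalvesSprungLowerHalfAtThreeFWLocus
import HarnessLib

/-!
# Route `SignedLowerHalves`, crux `SprungLowerHalfAtThree` (item stmt-BirchSwinnertonDyer-19003): clause (B)
# (`stub_chromaticDivisibility`) on X8 ∩ (Fouquet–Wan locus) at EVERY analytic rank, CLOSED MODULO the TWO
# OPEN binders `FouquetWan2021.cor53_finiteSelmer_iff_rankZero_OPEN` and `FouquetWan2021.cor54_pPart_rankZero_OPEN`
# (cell `bsd-ssimc`, seat `bsd-ssimc-k3-c5` gen 2; a `--supports … --as helper` file, closes nothing)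

PARTITION (cell bsd-ssimc): X8 (A8) ∩ FW locus — 121 of the 217 X8 cells of conductor < 5·10⁵ (planner
census `bsd-ssimc-plan/census/fw_x8.tsv`: rank 0 surj 68, rank 1 surj 53); class-wide: every `E/ℚ` with good
supersingular `3`, `a_3 = ±3` and a prime `ℓ ≠ 3` of non-split multiplicative reduction with `3 ∤ ord_ℓ(Δ)`
— at ANY analytic rank — types-the-object-of; closes NONE. THEOREMS ONLY; nothing booked; both binders are
UNREFEREED claims of ONE preprint (Fouquet–Wan arXiv:2107.13726 Thm. 5.1 ⇒ Cor. 5.3, Cor. 5.4) carried by name.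

Why this file: crux 5 is typed RANK-FREE (`∀ W p, ClassX8 W p → …`), and its clause (B) at a pair with
`Sel_{3^∞}(E/ℚ)` finite FORCES `L(E,1) ≠ 0` (`entireLFunction_one_ne_zero_and_missingLowerBoundAt_of_chromaticDatum`,
p417882) — the corank-zero converse (conv₀), open in analytic rank ≥ 2. The companion file
`SignedLowerHalvesSprungLowerHalfAtThreeFWLocus.lean` (p418174) therefore carried `W.analyticRank ≤ 1`
(where GZK settles (conv₀)). Fouquet–Wan PRINT that converse on their locus: Cor. 5.3 (= Cor. 1.9, p. 6 /
p. 53, verbatim «Let `f ∈ S_k(Γ₀(N))` be a normalized eigencuspform satisfying all the hypotheses of theorem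
5.1. Then `Sel_ℚ(f)` is a finite group if and only if `L(f,k/2) ≠ 0`»; `Sel_ℚ(f)` = the Bloch–Kato Selmer
group of `V/T`, = `Sel_{p^∞}(E/ℚ)` for an elliptic curve), typed by this seat as the Literature OPEN binder
`FouquetWan2021.cor53_finiteSelmer_iff_rankZero_OPEN` (same dictionary and locus as lev's
`cor54_pPart_rankZero_OPEN`). With BOTH binders the rank hypothesis disappears: on X8 ∩ FW locus,
`Sel_{3^∞}(E/ℚ)` infinite ⇒ (B) trivially (`ξ = h = 0`); finite ⇒ `r_an = 0` (Cor. 5.3 binder) ⇒ `BSD(E,3)`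
(Cor. 5.4 binder via `FouquetWan2021.bsdp_of_cor54_OPEN_of_analyticRank_eq_zero`: modularity `hnf`, GZK, period
facts) ⇒ `MissingLowerBoundAt W 3` ⇒ (B) (`chromaticDatum_of_missingLowerBoundAt`). So on the FW locus the
registered stub (B) is «PRE-closable» with NO extra hypothesis beyond the locus — exactly the crux's own
quantifier shape there. AUDIT FLAGS (honest, as in the companion): the cell's W-lev-9 audit of FW read
`a_p = 0`, `p ≥ 5`; A-KATO-3 is VOID on X8 ∩ FW locus (a ramified multiplicative prime forces surjective
`ρ̄_{E,3}`, and `ClassX8.imageContainsSL2_of_surj` — Wuthrich 2014 Lemma 20 — gives Kato's (12.5.2); not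
used below); the `a_3 = ±3` Eisenstein side (FW §7 / Thm. 7.32 over Wan's non-ordinary GU(3,1) families) is
UNAUDITED by the cell.

References: [FouquetWan2021] Thm. 5.1, Cor. 5.3, Cor. 5.4 (p. 53), Cor. 1.9/1.10 (p. 6) (PRE); [Sprung2017]
Cor. 4.11; [BlochKato1990] Ex. 3.11; [GreenbergVatsal2000] Rem. 3.4; [Wuthrich2014] Lemma 20; [Miller2011LMS] Def. 1.1.
-/

set_option autoImplicit false
set_option linter.dupNamespace false

noncomputable section

open scoped Classical MatrixGroups ModularForm

open CongruenceSubgroup WeierstrassCurve Literature.NumberTheory.EllipticCurves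
  Literature.NumberTheory.EllipticCurves.ModularForms
  Literature.NumberTheory.EllipticCurves.Rank1Residual
  Literature.NumberTheory.EllipticCurves.Rank1Residual.Typed
  Literature.NumberTheory.EllipticCurves.Sprung2017
  Summit.BirchSwinnertonDyer.Rank1Residual.Supersingular

namespace Summit.BirchSwinnertonDyer.BirchSwinnertonDyer.Theorems

/-- **X8 ∩ (Fouquet–Wan locus), ANY analytic rank: `stub_chromaticDivisibility` MODULO the TWO OPEN binders
`FouquetWan2021.cor53_finiteSelmer_iff_rankZero_OPEN` (corank-0 converse) and
`FouquetWan2021.cor54_pPart_rankZero_OPEN` (rank-0 `p`-part).** For a globally minimal `W` on class X8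
(`p = 3`, good supersingular, `a_3 = ±3`) with a prime `ℓ ≠ 3` of NON-SPLIT multiplicative reduction and
`3 ∤ ord_ℓ(Δ_min)`: IF both claimed corollaries of Fouquet–Wan's Thm. 5.1 hold (`hFW53_OPEN`, `hFW54_OPEN`,
UNREFEREED; typed for any odd good supersingular prime, `a_p ≠ 0` included, as printed), then for the newform
`f` of `W`, its period ratio `ϖ` and ANY Sprung pair, clause (B) of crux 5 holds (colour `♭`) — with NO
analytic-rank hypothesis. Cases on `Finite Sel_{3^∞}(E/ℚ)`: infinite ⇒ `chromaticDatum_of_not_finite_selmer`;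
finite ⇒ `r_an = 0` by the Cor. 5.3 binder (`FouquetWan2021.analyticRank_eq_zero_of_finite_selmer_of_cor53_OPEN`)
⇒ the companion theorem `X8_chromaticDivisibility_fwLocus_of_cor54_OPEN_of_analyticRank_le_one` at
`r_an = 0 ≤ 1`. CONDITIONAL; closes nothing; nothing booked. [claim: FouquetWan2021, status: under-review]
[cite: Sprung2017, Cor. 4.11 (table of special values)] [cite: GreenbergVatsal2000, §3 Remark 3.4]
[cite: Miller2011LMS, Def. 1.1] -/
theorem X8_chromaticDivisibility_fwLocus_of_cor53_cor54_OPEN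
    (hFW53_OPEN : FouquetWan2021.cor53_finiteSelmer_iff_rankZero_OPEN)
    (hFW54_OPEN : FouquetWan2021.cor54_pPart_rankZero_OPEN)
    (hnf : exists_isNewformOf) (hGZK : rank_eq_analyticRank_of_analyticRank_le_one)
    (hmod : hasEntireLFunction_rat)
    (h5 : realPeriodRat_eq_unit_mul_plusPeriod) (h3 : realPeriodRat_eq_unit_mul_plusPeriod_three)
    (W : WeierstrassCurve ℚ) [W.IsElliptic] [W.IsGloballyMinimal] (p : ℕ) [Fact p.Prime]
    (hX : ClassX8 W p)
    (hFW : ∃ (ℓ : ℕ) (_ : Fact ℓ.Prime), ℓ ≠ p ∧ W.HasMultiplicativeReductionAtPrime ℓ ∧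
        ¬ W.HasSplitMultiplicativeReductionAtPrime ℓ ∧ ¬ p ∣ padicValInt ℓ W.minimalDiscriminantInt)
    {N : ℕ} [NeZero N] {f : CuspForm (Gamma0 N) 2} (hf : IsNewformOf W f)
    {ϖ : ℚ} (hϖ : (ϖ : ℝ) * W.realPeriodRat = plusPeriod f)
    {Lsharp Lflat : IwasawaAlgebra p} (hSP : IsSprungPair f p (W.frobeniusTrace p) Lsharp Lflat) :
    ∃ (c : Chroma) (ξ : IwasawaAlgebra p), (⟨ξ, 0, 0⟩ : SignedDatum W p).EulerCharacteristic ∧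
      ∃ h : IwasawaAlgebra p, iwasawaToPowerSeries p ξ =
        PowerSeries.C (ϖ : ℚ_[p]) * iwasawaToPowerSeries p (chromaticL c Lsharp Lflat * h) := by
  have hp3 : p = 3 := hX.1
  subst hp3
  by_cases hfin : Finite (W.selmerGroupPInfty 3)
  · have hr0 : W.analyticRank = 0 :=
      FouquetWan2021.analyticRank_eq_zero_of_finite_selmer_of_cor53_OPEN hFW53_OPEN W 3 (by decide)
        hX.2.1.1 hX.2.1.2 hFW hfin
    exact X8_chromaticDivisibility_fwLocus_of_cor54_OPEN_of_analyticRank_le_one hFW54_OPEN hnf hGZK hmod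
      h5 h3 W 3 hX hFW (by omega) hf hϖ hSP
  · obtain ⟨ξ, hK, hdiv⟩ := chromaticDatum_of_not_finite_selmer W 3 hfin ϖ (chromaticL .flat Lsharp Lflat)
    exact ⟨.flat, ξ, hK, hdiv⟩

/-- **The same in the registered stub's binder order** — `stub_chromaticDivisibility` VERBATIM after the two
OPEN binders, the published facts (modularity, GZK, `hasEntireLFunction_rat`, period-ratio units) and ONE
locus hypothesis (the Fouquet–Wan prime), with NO analytic-rank hypothesis: on X8 ∩ FW locus the crux's
clause (B) is «PRE-closable» in exactly the crux's own quantifier shape. What it buys on X8: 121 of 217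
cells of board A8 (rank 0: 68, all on the leaf's branch `r_an = 0 ∧ surj`; rank 1: 53) and, class-wide, the
FW locus at analytic rank ≥ 2 as well (where (B) says «`Sel_{3^∞}(E/ℚ)` is infinite»). CONDITIONAL; closes
nothing. [claim: FouquetWan2021, status: under-review] [cite: Miller2011LMS, Def. 1.1] -/
theorem stub_chromaticDivisibility_fwLocus_of_cor53_cor54_OPEN
    (hFW53_OPEN : FouquetWan2021.cor53_finiteSelmer_iff_rankZero_OPEN)
    (hFW54_OPEN : FouquetWan2021.cor54_pPart_rankZero_OPEN)
    (hnf : exists_isNewformOf) (hGZK : rank_eq_analyticRank_of_analyticRank_le_one)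
    (hmod : hasEntireLFunction_rat)
    (h5 : realPeriodRat_eq_unit_mul_plusPeriod) (h3 : realPeriodRat_eq_unit_mul_plusPeriod_three) :
    ∀ (W : WeierstrassCurve ℚ) [W.IsElliptic] [W.IsGloballyMinimal] (p : ℕ) [Fact p.Prime],
      Literature.NumberTheory.EllipticCurves.Rank1Residual.ClassX8 W p →
      (∃ (ℓ : ℕ) (_ : Fact ℓ.Prime), ℓ ≠ p ∧ W.HasMultiplicativeReductionAtPrime ℓ ∧
        ¬ W.HasSplitMultiplicativeReductionAtPrime ℓ ∧ ¬ p ∣ padicValInt ℓ W.minimalDiscriminantInt) →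
      ∀ (N : ℕ) (_ : NeZero N) (f : CuspForm (CongruenceSubgroup.Gamma0 N) 2) (ϖ : ℚ)
        (Lsharp Lflat : Literature.NumberTheory.EllipticCurves.IwasawaAlgebra p),
        Literature.NumberTheory.EllipticCurves.ModularForms.IsNewformOf W f →
        (ϖ : ℝ) * W.realPeriodRat = Literature.NumberTheory.EllipticCurves.ModularForms.plusPeriod f →
        Literature.NumberTheory.EllipticCurves.Sprung2017.IsSprungPair f p (W.frobeniusTrace p)
          Lsharp Lflat →
        ∃ (c : Literature.NumberTheory.EllipticCurves.Sprung2017.Chroma)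
          (ξ : Literature.NumberTheory.EllipticCurves.IwasawaAlgebra p),
          (⟨ξ, 0, 0⟩ : Summit.BirchSwinnertonDyer.Rank1Residual.Supersingular.SignedDatum W p).EulerCharacteristic ∧
          ∃ h : Literature.NumberTheory.EllipticCurves.IwasawaAlgebra p,
            Literature.NumberTheory.EllipticCurves.iwasawaToPowerSeries p ξ =
              PowerSeries.C (ϖ : ℚ_[p]) *
                Literature.NumberTheory.EllipticCurves.iwasawaToPowerSeries p
                  (Literature.NumberTheory.EllipticCurves.Sprung2017.chromaticL c Lsharp Lflat * h) := by
  intro W _ _ p _ hX hFW N hN f ϖ Lsharp Lflat hf hϖ hSP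
  exact X8_chromaticDivisibility_fwLocus_of_cor53_cor54_OPEN hFW53_OPEN hFW54_OPEN hnf hGZK hmod h5 h3
    W p hX hFW hf hϖ hSP

end Summit.BirchSwinnertonDyer.BirchSwinnertonDyer.Theorems

end
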